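import Literature.MathematicalPhysics.QuantumFieldTheory.Balaban1983to89.Node00.TorusCoverGaugeAveragesZd
import Literature.MathematicalPhysics.QuantumFieldTheory.Balaban1983to89.B7Eq78Linearization

/-!
# NODE 00 — THE TORUS→`ℤᵈ` TWIN, FILE 40b: [6] (1.29)'s GENERIC `Rbar` OVER THE CENTRED BLOCKING `zdBlockingZ` AT THE TRIVIAL BACKGROUND IS THE (79)–(80) TWIN `uavgZ L 1`,
# hence a (1.29) statement in n05-d's currency «`Rbar (zdBlockingZ d L) (bgTZ L 1) j (↑∘u) y = 1` on the cells» (`Restr129Z L k Λ 1 u`) READS, under the cover, as the `Nrm` row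
# «`gaugeAvgIter (loopAvgBlockOp expMeanLogSU) g j y = 1`» of N07's `NrmOfRecordWide`

Cell `pub-ymgap`, width seat `pub-ymgap-dag-n07-w3` generation 9 (torus push-down lineage), N05-REC road item R7, row (B-Nrm-mean) of the door plan `HOME/pub-ymgap-dag-n07-w3/R7-DOOR-PLAN.md`.
WHY.  The twin crown will deliver the (1.29)∕(81) normalisation of its gauge in [6]'s GENERIC letters — n05-d's R2 draft `B8Eq119TwistedAxialRec` types `Restr129Z L k Λ U₀ u := ∀ j ≤ k,
∀ y ∈ Λ j, Rbar (zdBlockingZ d L) (bgTZ L U₀) j (↑∘u) y = 1` with the engine's `B7Eq78Linearization.Rbar` instantiated at dag-n05-e's centred blocking `zdBlockingZ` (R0b-2 §9, p691879)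
and `bgTZ L 1 = 1` (`restr129Z_one_iff`) — while FILE 40 (`Node00.TorusCoverGaugeAveragesZd`) reads NODE 00's torus averages through R0b-1∕R0b-2's recursions `uavgZ ∕ uavgZG`.  §1 is
the ℤᵈ-internal link `Rbar (zdBlockingZ d L) 1 = uavgZ L 1` (both are (78)'s `v(y)·exp[Σ_{x∈B(y)} L⁻ᵈ log v(y)⁻¹v(x)]` iterated from the centre `L·y`; the only work is the block sum
`Σ_{x ∈ blockSitesZ L y} = Σ_r` by injectivity of `r ↦ L·y + offZ L r`), §2 the cover corollaries.  `--kind proof --supports stmt-QuantumFields-20541` (K0⁷; count-neutral; THEOREMS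
ONLY, 0 `def`).  CONSUMED BY NAME, nothing modified: n05-a's `B7Eq78Linearization` (`Rbar avgStep conjR`), dag-n05-e's `B7SectCDGaugeAveragesRec` (`SexpZ savgZ uavgZ R0avgZ`) and
`B7SectEFLinearisationRec` (`zdBlockingZ blockSitesZ uavgZG`), `BlockAveragingZd` (`offZ ctrShift avgIterZ_one`), `B7Eq99Concrete.R0fun_one_left`, FILE 40 (`uavgZ(G)_one_coverLift_eq_one_iff(_of_small)`).
[6] = [Balaban1985RegularSpaces]; [3] = [Balaban1985Averaging]; [I] = [Balaban1987RG1].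

WHAT IS PROVED (kernel; generic complete normed `ℂ`-algebra `𝔸` in §1, `SU(N)` under `ιSU` in §2; NO estimate).
§1 `smul_add_offZ_injective`, `sum_blockSitesZ`, ★★ `Rbar_zdBlockingZ_one_eq_uavgZ` (`Rbar (zdBlockingZ d L) 1 j (↑∘u) = ↑∘(uavgZ L 1 u j)`), `Rbar_zdBlockingZ_one_eq_one_iff`.
§2 ★★★ `Rbar_zdBlockingZ_one_coverLift_eq_one_iff_of_small` (top-anchored, `j ≤ k ≤ m + K`, on the small-field domain of the (78) families: `Rbar (zdBlockingZ) 1 j (↑∘ι∘g∘π∘(·+(Lᵏ−1)∕2·𝟙)) w = 1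
   ↔ gaugeAvgIter (loopAvgBlockOp expMeanLogSU) g j (π_j(w + (L^{k−j}−1)∕2·𝟙)) = 1`), `uavgZG_one_coverLift_eq_one_iff'` (the guarded currency, unconditional, at the `𝔸` level).
NOT HERE: `Restr129Z` by name (n05-d's file; one line when it lands); general backgrounds `U₀ ≠ 1` (`bgTZ L U₀` transporters — not read by `NrmOfRecordWide`).
HONEST FRAMING: count-neutral helper; bookkeeping — nothing of [3]∕[6]∕[I] asserted or discharged; `HThm4Rec` UNDISCHARGED (caveat (C-S3-1)); N07 ∕ N05 NOT discharged, N07 NOT claimable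
on road (β); counts unmoved; one finite 𝕋⁴ programme at fixed ε — R4 closes the conditional finite-𝕋⁴ rung `BalabanLadder.UV` only; the YM mass gap (Clay) is NOT proved by any of this;
nothing continuum ∕ ℝ⁴ ∕ OS.  No `def`, no `sorry`, no `instance`, no `notation`.
-/

set_option autoImplicit false

noncomputable section

open scoped BigOperators Matrix.Norms.L2Operator

namespace Literature.MathematicalPhysics.QuantumFieldTheory.Balaban1983to89.Node00

open B7Prop1Explicit renaming Site → SiteZ
open B7Eq78Linearization (Rbar Rbar_succ avgStep_eq_mul_exp_sum conjR)
open B7SectCDGaugeAveragesRec (SexpZ savgZ uavgZ)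
open B7SectEFLinearisationRec (zdBlockingZ blockSitesZ uavgZG)
open BlockAveragingZd (offZ ctrShift)
open B15Eq112TorusCover (cover)
open B14DomainGeom (Pt)
open ExpMeanLog (expMeanLogSU deltaSU)

/-! ## §1  `Rbar (zdBlockingZ d L) 1 = uavgZ L 1` on `ℤᵈ` -/

section Zd

variable {d : ℕ} (L : ℕ) {𝔸 : Type*} [NormedRing 𝔸] [NormedAlgebra ℂ 𝔸] [CompleteSpace 𝔸]

/-- The centred block points `r ↦ L·y + offZ L r` are pairwise distinct. [cite: Balaban1987RG1, (0.3) p.252] -/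
theorem smul_add_offZ_injective (y : SiteZ d) : Function.Injective fun r : Fin d → Fin L => (L : ℤ) • y + offZ L r := by
  intro r r' h
  funext i
  have hi := congrFun h i
  simp only [Pi.add_apply, BlockAveragingZd.offZ_apply, add_right_inj, sub_left_inj, Nat.cast_inj] at hi
  exact Fin.ext hi

/-- A sum over the centred block `blockSitesZ L y` is the sum over the offsets `r ∈ {0,…,L−1}ᵈ`. [cite: Balaban1987RG1, (0.3) p.252] -/
theorem sum_blockSitesZ {M : Type*} [AddCommMonoid M] (y : SiteZ d) (f : SiteZ d → M) :
    ∑ x ∈ blockSitesZ L y, f x = ∑ r : Fin d → Fin L, f ((L : ℤ) • y + offZ L r) := by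
  unfold blockSitesZ
  rw [Finset.sum_image fun r _ r' _ h => smul_add_offZ_injective L y h]

/-- ★★ **[6] (1.29)'s GENERIC `R̄₀ʲ` OVER THE CENTRED BLOCKING AT THE TRIVIAL BACKGROUND IS THE (79)–(80) TWIN `uavgZ L 1`**: for a unit-valued gauge function `u`,
`Rbar (zdBlockingZ d L) (fun _ _ _ => 1) j (↑∘u) = ↑∘(uavgZ L 1 u j)` (n05-d's `Restr129Z L k Λ 1 u`, via `restr129Z_one_iff`, is «`Rbar … 1 j (↑∘u) y = 1` on the cells»).
[cite: Balaban1985RegularSpaces, (1.29) p.81; Balaban1985Averaging, (78)–(80) p.30] -/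
theorem Rbar_zdBlockingZ_one_eq_uavgZ (u : SiteZ d → 𝔸ˣ) :
    ∀ j : ℕ, Rbar (zdBlockingZ d L) (fun _ _ _ => (1 : 𝔸ˣ)) j (fun x => ((u x : 𝔸ˣ) : 𝔸)) = fun y => ((uavgZ L (1 : SiteZ d → Fin d → 𝔸ˣ) u j y : 𝔸ˣ) : 𝔸)
  | 0 => rfl
  | j + 1 => by
    funext y
    rw [Rbar_succ, Rbar_zdBlockingZ_one_eq_uavgZ u j, B7SectCDGaugeAveragesRec.uavgZ_succ, B7SectCDGaugeAveragesRec.R0avgZ,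
      BlockAveragingZd.avgIterZ_one, B7Eq99Concrete.R0fun_one_left, avgStep_eq_mul_exp_sum, B7SectCDGaugeAveragesRec.savgZ,
      Units.val_mul, B7Prop1Explicit.val_expUnit]
    show _ = _ * NormedSpace.exp (SexpZ L _ ((L : ℤ) • y))
    unfold SexpZ
    congr 2
    show ∑ x ∈ blockSitesZ L y, _ = _
    rw [sum_blockSitesZ]
    refine Finset.sum_congr rfl fun r _ => ?_
    congr 2
    rw [Ring.inverse_unit, conjR, Units.val_one, inv_one, Units.val_one, one_mul, mul_one, Units.val_mul]
    rfl

/-- Pointwise: `Rbar (zdBlockingZ d L) 1 j (↑∘u) y = 1 ↔ uavgZ L 1 u j y = 1`. [cite: Balaban1985RegularSpaces, (1.29) p.81] -/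
theorem Rbar_zdBlockingZ_one_eq_one_iff (u : SiteZ d → 𝔸ˣ) (j : ℕ) (y : SiteZ d) :
    Rbar (zdBlockingZ d L) (fun _ _ _ => (1 : 𝔸ˣ)) j (fun x => ((u x : 𝔸ˣ) : 𝔸)) y = 1 ↔ uavgZ L (1 : SiteZ d → Fin d → 𝔸ˣ) u j y = 1 := by
  rw [Rbar_zdBlockingZ_one_eq_uavgZ L u j]
  exact Units.val_eq_one

end Zd

/-! ## §2  Under the cover: (1.29) in the twin's currency ↔ the `Nrm` row of `NrmOfRecordWide` -/

section Cover

variable {P : Params} (N : ℕ) [NeZero N]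

/-- ★★★ **(1.29) FOR THE LIFT, IN [6]'s GENERIC `Rbar`-OVER-`zdBlockingZ` CURRENCY, IS THE TORUS NORMALISATION ROW** (top-anchored, `j ≤ k ≤ m + K`, on the small-field domain of the
(78) families of `R̄^{j′}g`, `j′ < k`): `Rbar (zdBlockingZ d L) 1 j (↑∘ι∘g∘π∘(·+(Lᵏ−1)∕2·𝟙)) w = 1 ↔ gaugeAvgIter (loopAvgBlockOp expMeanLogSU) g j (π_j(w + (L^{k−j}−1)∕2·𝟙)) = 1` — the
left side is n05-d's `Restr129Z L k Λ 1 (lift g)` clause at the cell `w`, the right side the `Nrm` row of N07's `NrmOfRecordWide` at the torus cell `π_j(…)`.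
[cite: Balaban1985RegularSpaces, (1.29) p.81; Balaban1985Averaging, (78)–(81) p.30; Balaban1987RG1, (0.3) p.252] -/
theorem Rbar_zdBlockingZ_one_coverLift_eq_one_iff_of_small {k : ℕ} (hk : k ≤ P.m + P.K) (g : GaugeTransf P 0 (SU N))
    (hs : ∀ j, j < k → ∀ (y : Site P (j + 1)) (r : Fin P.d → Fin P.L),
      dist1 ((gaugeAvgIter (loopAvgBlockOp expMeanLogSU) g j (emb y))⁻¹ * gaugeAvgIter (loopAvgBlockOp expMeanLogSU) g j (Site.blockSite y r)) < deltaSU (Fin N))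
    {j : ℕ} (hj : j ≤ k) (w : Pt P.d) :
    Rbar (zdBlockingZ P.d P.L) (fun _ _ _ => (1 : (MatA N)ˣ)) j
        (fun x => ((ιSU N (g (cover P (x + fun _ => ((ctrShift P.L k : ℕ) : ℤ))))) : MatA N)) w = 1 ↔
      gaugeAvgIter (loopAvgBlockOp expMeanLogSU) g j (coverAt P j (w + fun _ => ((ctrShift P.L (k - j) : ℕ) : ℤ))) = 1 := by
  rw [Rbar_zdBlockingZ_one_eq_one_iff]
  exact uavgZ_one_coverLift_eq_one_iff_of_small N hk g hs hj w

/-- ★★ The same through the GUARDED edition: `uavgZG L δ_N 1 (lift g) j w = 1 ↔ gaugeAvgIter … = 1` holds WITHOUT smallness (FILE 40), and on the small-field domain `uavgZG = uavgZ =`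
[6]'s `Rbar`; so a (1.29) statement delivered in the guarded currency transfers unconditionally. [cite: Balaban1985RegularSpaces, (1.29) p.81; Balaban1987RG1, (0.4) p.253] -/
theorem uavgZG_one_coverLift_eq_one_iff' {k : ℕ} (hk : k ≤ P.m + P.K) (g : GaugeTransf P 0 (SU N)) {j : ℕ} (hj : j ≤ k) (w : Pt P.d) :
    ((uavgZG P.L (deltaSU (Fin N)) (1 : Pt P.d → Fin P.d → (MatA N)ˣ)
        (fun x => ιSU N (g (cover P (x + fun _ => ((ctrShift P.L k : ℕ) : ℤ))))) j w : (MatA N)ˣ) : MatA N) = 1 ↔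
      gaugeAvgIter (loopAvgBlockOp expMeanLogSU) g j (coverAt P j (w + fun _ => ((ctrShift P.L (k - j) : ℕ) : ℤ))) = 1 := by
  rw [Units.val_eq_one]
  exact uavgZG_one_coverLift_eq_one_iff N hk g hj w

end Cover

end Literature.MathematicalPhysics.QuantumFieldTheory.Balaban1983to89.Node00

end
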